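import Literature.Computability.Complexity.BoundedArithmeticHerbrandData
import Literature.Computability.MetaComplexity.BoundedArithS2SuccIND
import HarnessLib

/-!
# Bounded arithmetic (`pnp` walls): discharges of the chain `T₂ⁱ ⊆ S₂ⁱ⁺¹` and of `S₂ⁱ⁺¹ ≡_{∀Σᵇᵢ₊₁} T₂ⁱ`

Sibling proof file of `BoundedArithmetic.lean` (D-0014: named facts `def X : Prop` are discharged
as `theorem X_holds : X`).  Combining

* Buss's conservation theorem `S2_succ_isConservativeOver_T2_holds`
  (`BoundedArithmeticHerbrandData.lean`; Buss 1990, Thm. 5: for `i ≥ 1`, `S₂ⁱ⁺¹` is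
  `∀Σᵇᵢ₊₁`-conservative over `T₂ⁱ`), and
* the inclusion `T₂ⁱ ⊆ S₂ⁱ⁺¹`, `T2_extends_S2_succ_holds`
  (`Literature/Computability/MetaComplexity/BoundedArithS2SuccIND.lean`; Buss 1990, §1, p. 3;
  Krajíček 1995, Lemma 5.2.8),

this file discharges the named facts of `BoundedArithmetic.lean`

* `T2_extends_to_S2_succ` (`T2_extends_to_S2_succ_holds`),
* `models_S2_succ_of_models_T2` (`models_S2_succ_of_models_T2_holds`),
* `isSigmabDefinable_S2_succ_of_isSigmabDefinable_T2`
  (`isSigmabDefinable_S2_succ_of_isSigmabDefinable_T2_holds`),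
* `models_S2_succ_iff_models_T2` (`models_S2_succ_iff_models_T2_holds`): for `i ≥ 1` and a
  `∀Σᵇᵢ₊₁` sentence `φ`, `S₂ⁱ⁺¹ ⊢ φ ↔ T₂ⁱ ⊢ φ` (Buss 1990, Thm. 5 combined with `T₂ⁱ ⊆ S₂ⁱ⁺¹`),

exactly by the interim proofs preserved as comments in `BoundedArithmetic.lean`; and, from the
axiom-wise monotonicities `T2_mono_holds`, `S2_mono_holds` (`T₂ⁱ ⊆ T₂ʲ`, `S₂ⁱ ⊆ S₂ʲ` for `i ≤ j`,
`Literature/Computability/MetaComplexity/BoundedArithTheoriesProofs.lean`),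

* `T2_extends_to_T2_succ` (`T2_extends_to_T2_succ_holds`): `T₂ⁱ⁺¹` extends `T₂ⁱ` for every `i`
  (Buss 1986, §2.4; Krajíček 1995, Def. 5.2.2, p. 66: `T₂ⁱ = BASIC + Σᵇᵢ-IND`, and every
  `Σᵇᵢ-IND` axiom is a `Σᵇᵢ₊₁-IND` axiom);
* `S2_extends_to_S2_succ` (`S2_extends_to_S2_succ_holds`): `S₂ⁱ⁺¹` extends `S₂ⁱ` for every `i`
  (Buss 1986, §2.4; Krajíček 1995, Def. 5.2.3, p. 66: `S₂ⁱ = BASIC + Σᵇᵢ-PIND`, and every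
  `Σᵇᵢ-PIND` axiom is a `Σᵇᵢ₊₁-PIND` axiom).

Finally, from `T₂ⁱ ⊆ S₂ⁱ⁺¹` and the hypothesis itself,

* `models_T2_iff_models_S2_succ_of_t2EqS2Succ`
  (`models_T2_iff_models_S2_succ_of_t2EqS2Succ_holds`): under the KPT hypothesis `T₂ⁱ = S₂ⁱ⁺¹`
  (`T2EqS2Succ i`) the theories `T₂ⁱ` and `S₂ⁱ⁺¹` have the same consequences (KPT 1991, §3,
  proof of Thm. B, p. 152);

and, again from `S2_mono_holds`, the reduction of the named fact
`isSigmabDefinable_S2_of_polyTimeComputable` ("every polynomial-time function is `Σᵇ₁`-definable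
in `S₂ⁱ`, `i ≥ 1`") to its instance `i = 1`, the named fact
`isSigmabDefinable_S2_one_of_polyTimeComputable` (the easy direction of Buss's Main Theorem:
Buss 1986, Ch. 5; Krajíček 1995, Lemma 6.1.1 (p. 86) with Thm. 7.2.3 (1) (pp. 97–98): every
polynomial-time function is `Σᵇ₁`-definable in `S₂¹`):

* `isSigmabDefinable_S2_of_polyTimeComputable_of_S2_one` — the interim proof preserved as a
  comment in `BoundedArithmetic.lean` (`mono_subset (S2_mono hi)`), now with `S2_mono_holds`;
* `isSigmabDefinable_S2_of_polyTimeComputable_iff_S2_one` — the two named facts are equivalent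
  (the converse is the instance `i = 1`), so the former is discharged by exactly the latter.

## References

* S. R. Buss, *Bounded Arithmetic*, Bibliopolis 1986, §2.4 (the theories `S₂ⁱ`, `T₂ⁱ`), Ch. 5
  (Main Theorem: the `Σᵇ₁`-definable functions of `S₂¹` are exactly the polynomial-time functions).
* S. R. Buss, *Axiomatizations and conservation results for fragments of bounded arithmetic*,
  in: Logic and Computation, Contemp. Math. 106, AMS 1990, pp. 57–84: §1 (p. 3), Thm. 5 (p. 8).
* J. Krajíček, *Bounded Arithmetic, Propositional Logic and Complexity Theory*, CUP 1995,
  Def. 5.2.2–5.2.3 (p. 66), Lemma 5.2.8 (p. 68), Lemma 6.1.1 (p. 86), Thm. 7.2.3 (pp. 97–98),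
  Cor. 7.2.4 (p. 100).
* J. Krajíček, P. Pudlák, G. Takeuti, *Bounded arithmetic and the polynomial hierarchy*,
  Ann. Pure Appl. Logic 52 (1991), 143–153: Introduction (p. 144), §3, Thm. B (p. 152).
-/

namespace Literature.Computability.Complexity

open FirstOrder FirstOrder.Language MetaComplexity

/-- **Discharge of `T2_extends_to_S2_succ`**: `S₂ⁱ⁺¹` extends `T₂ⁱ` for every `i` — every
`Σᵇᵢ-IND` axiom is a consequence of `BASIC + Σᵇᵢ₊₁-PIND` (Buss 1990, §1, p. 3; Krajíček 1995,
Lemma 5.2.8); this is `MetaComplexity.T2_extends_S2_succ_holds`.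
[cite: BussContempMath1990, §1 (p. 3)] -/
theorem T2_extends_to_S2_succ_holds : T2_extends_to_S2_succ :=
  T2_extends_S2_succ_holds

/-- **Discharge of `models_S2_succ_of_models_T2`**: every consequence of `T₂ⁱ` is a consequence
of `S₂ⁱ⁺¹` (Buss 1990, §1, p. 3: `T₂ⁱ ⊆ S₂ⁱ⁺¹`). [cite: BussContempMath1990, §1 (p. 3)] -/
theorem models_S2_succ_of_models_T2_holds : models_S2_succ_of_models_T2 := by
  intro i φ h
  exact (T2_extends_S2_succ_holds i).models h

/-- **Discharge of `isSigmabDefinable_S2_succ_of_isSigmabDefinable_T2`**: a function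
`Σᵇⱼ`-definable in `T₂ⁱ` is `Σᵇⱼ`-definable in `S₂ⁱ⁺¹` (from `T₂ⁱ ⊆ S₂ⁱ⁺¹`, Buss 1990, §1, p. 3).
[cite: BussContempMath1990, §1 (p. 3)] -/
theorem isSigmabDefinable_S2_succ_of_isSigmabDefinable_T2_holds :
    isSigmabDefinable_S2_succ_of_isSigmabDefinable_T2 := by
  intro i j f hf
  exact hf.mono_theory (T2_extends_S2_succ_holds i)

/-- **Discharge of `models_S2_succ_iff_models_T2`**: for `i ≥ 1` and a `∀Σᵇᵢ₊₁` sentence `φ`,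
provability (`⊨ᵇ`) in `S₂ⁱ⁺¹` and in `T₂ⁱ` coincide — Buss's conservation theorem (Buss 1990,
Thm. 5, p. 8: `S₂ⁱ⁺¹` is `∀Σᵇᵢ₊₁`-conservative over `T₂ⁱ`; `S2_succ_isConservativeOver_T2_holds`)
combined with `T₂ⁱ ⊆ S₂ⁱ⁺¹` (Buss 1990, §1, p. 3; `T2_extends_S2_succ_holds`).
[cite: BussContempMath1990, Thm. 5 (p. 8) and §1 (p. 3)] -/
theorem models_S2_succ_iff_models_T2_holds : models_S2_succ_iff_models_T2 := by
  intro i hi φ hφ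
  exact (S2_succ_isConservativeOver_T2_holds hi).models_iff (T2_extends_S2_succ_holds i) hφ

/-- **Discharge of `T2_extends_to_T2_succ`**: `T₂ⁱ⁺¹` extends `T₂ⁱ` for every `i`, i.e.
every axiom of `T₂ⁱ` is a consequence of `T₂ⁱ⁺¹`.  Indeed `T₂ⁱ ⊆ T₂ⁱ⁺¹` axiom-wise: both contain
`BASIC`, and since the classes `Σᵇᵢ` are cumulative every `Σᵇᵢ-IND` axiom is a `Σᵇᵢ₊₁-IND`
axiom (Buss 1986, §2.4; Krajíček 1995, Def. 5.2.2, p. 66, `T₂ⁱ = BASIC + Σᵇᵢ-IND`); this is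
`MetaComplexity.T2_mono_holds` at `i ≤ i + 1`, and a supertheory extends its subtheories
(`Theory.Extends.of_subset`).  Exactly the interim proof preserved as a comment in
`BoundedArithmetic.lean`. [cite: Buss1986, §2.4] [cite: Krajicek1995, Def. 5.2.2 (p. 66)] -/
theorem T2_extends_to_T2_succ_holds : T2_extends_to_T2_succ := by
  intro i
  exact Theory.Extends.of_subset (T2_mono_holds (Nat.le_succ i))

/-- **Discharge of `models_T2_iff_models_S2_succ_of_t2EqS2Succ`**: under the hypothesis
`T₂ⁱ = S₂ⁱ⁺¹` of Krajíček–Pudlák–Takeuti (`T2EqS2Succ i`: `T₂ⁱ` proves every axiom of `S₂ⁱ⁺¹`)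
the theories `T₂ⁱ` and `S₂ⁱ⁺¹` have the same consequences (`⊨ᵇ`).  Immediate from the two
extensions: `T₂ⁱ ⊆ S₂ⁱ⁺¹` always holds (Buss 1990, §1, p. 3; Krajíček 1995, Lemma 5.2.8;
`T2_extends_S2_succ_holds`), and the converse is the hypothesis.  This is exactly how the
hypothesis is used in Krajíček–Pudlák–Takeuti, *Bounded arithmetic and the polynomial
hierarchy*, Ann. Pure Appl. Logic 52 (1991), §3, proof of Thm. B (p. 152): "Assume
`T₂ⁱ = S₂ⁱ⁺¹`. Then `T₂ⁱ ⊢ φ(a)`" for a formula `φ(a)` proved in `S₂ⁱ⁺¹` (the hypothesis is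
introduced in the Introduction, p. 144).
[cite: KPT1991, §3, proof of Thm. B (p. 152)] [cite: BussContempMath1990, §1 (p. 3)] -/
theorem models_T2_iff_models_S2_succ_of_t2EqS2Succ_holds :
    models_T2_iff_models_S2_succ_of_t2EqS2Succ := by
  intro i h φ
  exact ⟨(T2_extends_S2_succ_holds i).models, h.models⟩

/-- **Discharge of `S2_extends_to_S2_succ`**: `S₂ⁱ⁺¹` extends `S₂ⁱ` for every `i`, i.e.
every axiom of `S₂ⁱ` is a consequence of `S₂ⁱ⁺¹`.  Indeed `S₂ⁱ ⊆ S₂ⁱ⁺¹` axiom-wise: both contain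
`BASIC`, and since the classes `Σᵇᵢ` are cumulative every `Σᵇᵢ-PIND` axiom is a `Σᵇᵢ₊₁-PIND`
axiom (Buss 1986, §2.4; Krajíček 1995, Def. 5.2.3, p. 66, `S₂ⁱ = BASIC + Σᵇᵢ-PIND`); this is
`MetaComplexity.S2_mono_holds` at `i ≤ i + 1`, and a supertheory extends its subtheories
(`Theory.Extends.of_subset`).  Exactly the interim proof preserved as a comment in
`BoundedArithmetic.lean`. [cite: Buss1986, §2.4] [cite: Krajicek1995, Def. 5.2.3 (p. 66)] -/
theorem S2_extends_to_S2_succ_holds : S2_extends_to_S2_succ := by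
  intro i
  exact Theory.Extends.of_subset (S2_mono_holds (Nat.le_succ i))

/-! ## `Σᵇ₁`-definability of polynomial-time functions: `S₂ⁱ` (`i ≥ 1`) versus `S₂¹` -/

/-- **Reduction of `isSigmabDefinable_S2_of_polyTimeComputable` to its instance `i = 1`.**  If
every polynomial-time function `f : ℕ → ℕ` (`PolyTimeComputable encodeNat encodeNat f`) is
`Σᵇ₁`-definable in `S₂¹` — the named fact `isSigmabDefinable_S2_one_of_polyTimeComputable`, the
easy direction of Buss's Main Theorem (Buss 1986, Ch. 5; Krajíček 1995, Lemma 6.1.1, p. 86: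
`PV₁ ⊢ ∀ x ∃! w Comp_M(x, w, ∅)` for every polynomial-time machine `M`, and Thm. 7.2.3 (1),
pp. 97–98: the witnessing function "is `□ᵖ₁` and it is `Σᵇ₁`-definable in `S₂¹`") — then it is
`Σᵇ₁`-definable in `S₂ⁱ` for every `i ≥ 1`: the defining `Σᵇ₁` formula is kept, and its totality
and uniqueness sentences, being consequences of `S₂¹`, are consequences of the larger axiom set
`S₂ⁱ ⊇ S₂¹` (`S2_mono_holds`, Buss 1986, §2.4; `IsSigmabDefinable.mono_subset`).  This is exactly
the interim proof preserved as a comment in `BoundedArithmetic.lean`.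
[cite: Buss1986, §2.4 and Ch. 5] [cite: Krajicek1995, Lemma 6.1.1 (p. 86) and Thm. 7.2.3 (pp. 97–98)] -/
theorem isSigmabDefinable_S2_of_polyTimeComputable_of_S2_one
    (h : isSigmabDefinable_S2_one_of_polyTimeComputable) :
    isSigmabDefinable_S2_of_polyTimeComputable := by
  intro f i hi hf
  exact (h hf).mono_subset (S2_mono_holds hi)

/-- **The two named facts are equivalent.**  "Every polynomial-time function is `Σᵇ₁`-definable
in `S₂ⁱ` for every `i ≥ 1`" (`isSigmabDefinable_S2_of_polyTimeComputable`) holds if and only if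
"every polynomial-time function is `Σᵇ₁`-definable in `S₂¹`"
(`isSigmabDefinable_S2_one_of_polyTimeComputable`; Buss 1986, Ch. 5, easy direction of the Main
Theorem) does: the forward implication is the instance `i = 1`, the backward one is
`isSigmabDefinable_S2_of_polyTimeComputable_of_S2_one` (`S₂¹ ⊆ S₂ⁱ`, Buss 1986, §2.4).  Hence
the former named fact has no content beyond the latter. [cite: Buss1986, §2.4 and Ch. 5] -/
theorem isSigmabDefinable_S2_of_polyTimeComputable_iff_S2_one :
    isSigmabDefinable_S2_of_polyTimeComputable ↔
      isSigmabDefinable_S2_one_of_polyTimeComputable := by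
  refine ⟨fun h => ?_, isSigmabDefinable_S2_of_polyTimeComputable_of_S2_one⟩
  intro f hf
  exact h le_rfl hf

end Literature.Computability.Complexity
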